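/-
Copyright (c) 2026 the pub-hodgecm-mathlib formalisation cell (harness21).  Prover seat hodgecm-mathlib-K2Liu-p01 (g2): Track B «K2-LIT»,
#184♮ = hLiu418 = stmt-HodgeConjecture-24832, STEWARD of socket #41; organ O41.5 (Gindikin–Karpelevich), ROADMAP
`K2/K2Liu-p01/g2/ROADMAP-O41_5-GindikinKarpelevich.K2Liup01g2.md` a6873eb1b770b760, sub-organ O41.5e (algebraic half).
-/
import Literature.NumberTheory.GelbartRogawski1991.LocalDoubledUnitaryUnramifiedCell   -- ★ `nElem`, `weylDelta`, `matA`, `adapt`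
import Literature.NumberTheory.GelbartRogawski1991.DoubledUnitaryAdaptedSiegelDet       -- ★ `map_det_blkD_mul_det_blkA`, `det_eq_det_blkA_mul_det_blkD`
import Literature.NumberTheory.K2Lit.LocalSiegelIntertwining                          -- ★ D10 `unipDeltaLocal`
import HarnessLib

/-!
# Crux `HLiu418`, road `K2_Liu`, socket #41, organ O41.5e (algebraic half): `P_Δ` NORMALISES `N_Δ` (`p n(t) = n(A t D⁻¹) p`) and
# `w_Δ` SWAPS THE LEVI BLOCKS (`w_Δ m w_Δ ↦ diag(D, A)`, `σ(det D)·det A = 1`)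

Cell `hodgecm-mathlib`, crux item hLiu418 = `stmt-HodgeConjecture-24832`; squad K2 ∕ K2Liu; prover K2Liu-p01 (g2), steward of #41.
THEOREMS ONLY (no `def`, no instance, no notation, no named-fact hypothesis, no `sorry`); lane `--supports stmt-HodgeConjecture-24832`.
These are the two group-theoretic inputs of the (χ′, −s)-equivariance of `M_v(s)` (ROADMAP (R2)): conjugating `m ∈ M_Δ` through the integral
`∫_{N_Δ(F_v)} f(w_Δ u m h) du` uses (§1) `u m = m (m⁻¹ u m)` with `m⁻¹ n(t) m = n(A⁻¹ t D)` (the change of variables on `N_Δ ≅ Skew`) and (§2)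
`w_Δ m = (w_Δ m w_Δ) w_Δ` with `w_Δ m w_Δ ∈ M_Δ` of `Δ`-block `D` where `σ(det D) = (det A)⁻¹` — the source of `χ′ = (χ ∘ c)⁻¹` and of `s ↦ −s`.
* §1 `matA_inv`, `skew_conj` (`t` skew, `p ∈ P_Δ` ⇒ `A t D⁻¹` skew), **`siegel_mul_nElem`**: `p · n(t) = n(A t D⁻¹) · p` (`A = blkA`, `D = blkD` of `adapt (matA p)`);
  `nElem_conj_mem_unipDeltaLocal`.
* §2 for `m ∈ M_Δ(F_v)` (`C = 0 = B`): **`adapt_matA_weylDelta_mul_mul_weylDelta`**: `adapt(matA(w_Δ m w_Δ)) = diag(D, A)`; `isSiegelDelta_weylDelta_conj`,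
  `blkB_weylDelta_conj` (still Levi), `toBlocks_add_matA_weylDelta_conj` (`Δ`-block `D`), **`map_det_blkD_mul_det_blkA'`** (`σ(det D)·det A = 1`, ★).
[HarrisKudlaSweet1996, §1 (1.11)–(1.12)] [Kudla1994, §3] [MoeglinWaldspurger1995, II.1.6] [Casselman1980, §3].
HONEST LABEL.  Count-neutral helper; it retires nothing by itself: `HC_CM` is proved only modulo the 7 printed citations (2 remaining named inputs:
hLiu418 = `stmt-HodgeConjecture-24832`, h413 = `stmt-HodgeConjecture-24833`) until rung 0 closes.

## References
* [HarrisKudlaSweet1996] M. Harris, S. Kudla, W. J. Sweet, J. AMS 9 (1996): §1 (1.11)–(1.12).   * [Kudla1994] S. S. Kudla, Israel J. Math. 87 (1994): §3.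
* [MoeglinWaldspurger1995] C. Mœglin, J.-L. Waldspurger, CUP (1995): II.1.6 (`M(w, π)` and the Levi).   * [Casselman1980] W. Casselman, Compositio 40: §3.
-/

set_option autoImplicit false
set_option linter.dupNamespace false -- the mandated namespace repeats `HodgeConjecture.HodgeConjecture`

noncomputable section

open NumberField IsDedekindDomain Matrix
open Literature.NumberTheory.Automorphic Literature.NumberTheory.Automorphic.UnitaryGroup
open Literature.NumberTheory.GelbartRogawski1991.AdaptedBlocks
open Literature.NumberTheory.GelbartRogawski1991.UnitaryDualPair.LocalSplitting
open Literature.NumberTheory.K2Lit.LocalSiegelDoubled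

namespace Summit.HodgeConjecture.HodgeConjecture.Cruxes.HLiu418.K2LiuSiegelLeviWeylAlgebra

variable (F : Type) [Field F] [NumberField F] (E : Type) [Field E] [NumberField E] [Algebra F E]
  [Algebra.IsQuadraticExtension F E] (c : E ≃ₐ[F] E)
  {δ : E} (hcδ : c δ = -δ) (hδ : δ ≠ 0) {d : F} (hd : δ * δ = algebraMap F E d)
  (v : HeightOneSpectrum (𝓞 F)) (n : ℕ) {T₀ : Matrix (Fin n) (Fin n) F} (hT₀ : T₀.IsSymm) (hT₀d : IsUnit T₀.det)
  {JD : Matrix (Fin (n + n)) (Fin (n + n)) E} (hJD : JD = (gramD F n T₀).map (algebraMap F E))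

/-! ## §1 `P_Δ` normalises `N_Δ`: `p n(t) p⁻¹ = n(A t D⁻¹)` -/

omit [Algebra.IsQuadraticExtension F E] in
/-- on `P_Δ` the Levi blocks have unit determinants. [cite: Kudla1994, §3] -/
theorem isUnit_det_blkA_blkD {p : UnitaryGroup.localPi E c (n + n) JD v} (hC : blkC (matA F E c v n p) = 0) :
    IsUnit (blkA (matA F E c v n p)).det ∧ IsUnit (blkD (matA F E c v n p)).det := by
  have h := isUnit_det_matA F E c v n p
  rw [det_eq_det_blkA_mul_det_blkD hC] at h
  exact ⟨isUnit_of_mul_isUnit_left h, isUnit_of_mul_isUnit_right h⟩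

omit [Algebra.IsQuadraticExtension F E] in
/-- `matA p⁻¹ = (matA p)⁻¹`. [cite: Kudla1994, §3] -/
theorem matA_inv (p : UnitaryGroup.localPi E c (n + n) JD v) : matA F E c v n p⁻¹ = (matA F E c v n p)⁻¹ :=
  (Matrix.inv_eq_right_inv (by rw [matA_mul, mul_inv_cancel, matA_one])).symm

omit [Algebra.IsQuadraticExtension F E] in
/-- `adapt M⁻¹ = (adapt M)⁻¹` for invertible `M`. [cite: HarrisKudlaSweet1996, §1 (1.11)] -/
theorem adapt_inv {M : Matrix (Fin n ⊕ Fin n) (Fin n ⊕ Fin n) (LocalRing E v)} (hM : IsUnit M.det) : adapt M⁻¹ = (adapt M)⁻¹ := by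
  refine (Matrix.inv_eq_right_inv ?_).symm
  rw [← adapt_mul, Matrix.mul_nonsing_inv M hM, adapt_one]

omit [Algebra.IsQuadraticExtension F E] in
include hJD in
/-- **the adapted matrix of `p n(t) p⁻¹` is `(1, A t D⁻¹; 0, 1)`** for `p ∈ P_Δ(F_v)` (`A, B, D` the adapted blocks of `p`).
[cite: HarrisKudlaSweet1996, §1 (1.12)] [cite: Kudla1994, §3] -/
theorem adapt_matA_conj_nElem {p : UnitaryGroup.localPi E c (n + n) JD v} (hC : blkC (matA F E c v n p) = 0)
    {t : Matrix (Fin n) (Fin n) (LocalRing E v)} (ht : (t.map (conjLocal E c v))ᵀ * gramS F E v n T₀ + gramS F E v n T₀ * t = 0) :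
    adapt (matA F E c v n (p * nElem F E c v n hJD t ht * p⁻¹)) =
      Matrix.fromBlocks 1 (blkA (matA F E c v n p) * t * (blkD (matA F E c v n p))⁻¹) 0 1 := by
  obtain ⟨hAu, hDu⟩ := isUnit_det_blkA_blkD F E c v n hC
  have hAD : IsUnit (blkA (matA F E c v n p)) ↔ IsUnit (blkD (matA F E c v n p)) := by
    rw [Matrix.isUnit_iff_isUnit_det, Matrix.isUnit_iff_isUnit_det]; exact iff_of_true hAu hDu
  rw [← matA_mul, ← matA_mul, adapt_mul, adapt_mul, matA_inv, adapt_inv F E v n (isUnit_det_matA F E c v n p), adapt_matA_nElem,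
    adapt_eq (matA F E c v n p), hC, Matrix.inv_fromBlocks_zero₂₁_of_isUnit_iff _ _ _ hAD, Matrix.fromBlocks_multiply, Matrix.fromBlocks_multiply]
  simp only [Matrix.mul_one, Matrix.mul_zero, Matrix.zero_mul, add_zero, zero_add, Matrix.mul_nonsing_inv _ hAu,
    Matrix.mul_nonsing_inv _ hDu, Matrix.mul_neg, Matrix.add_mul, neg_zero]
  congr 1
  simp only [← Matrix.mul_assoc, Matrix.mul_nonsing_inv _ hAu, Matrix.one_mul]
  abel

omit [Algebra.IsQuadraticExtension F E] in
include hJD in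
/-- **`p n(t) p⁻¹ ∈ N_Δ(F_v)`** for `p ∈ P_Δ(F_v)`: the Siegel parabolic normalises its unipotent radical. [cite: HarrisKudlaSweet1996, §1 (1.12)] -/
theorem conj_nElem_mem_unipDeltaLocal {p : UnitaryGroup.localPi E c (n + n) JD v} (hC : blkC (matA F E c v n p) = 0)
    {t : Matrix (Fin n) (Fin n) (LocalRing E v)} (ht : (t.map (conjLocal E c v))ᵀ * gramS F E v n T₀ + gramS F E v n T₀ * t = 0) :
    p * nElem F E c v n hJD t ht * p⁻¹ ∈ unipDeltaLocal F E c v n (JD := JD) :=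
  ⟨_, adapt_matA_conj_nElem F E c v n hJD hC ht⟩

omit [Algebra.IsQuadraticExtension F E] in
include hJD in
/-- the adapted corner of `p n(t) p⁻¹` is `A t D⁻¹`. [cite: HarrisKudlaSweet1996, §1 (1.12)] -/
theorem blkB_matA_conj_nElem {p : UnitaryGroup.localPi E c (n + n) JD v} (hC : blkC (matA F E c v n p) = 0)
    {t : Matrix (Fin n) (Fin n) (LocalRing E v)} (ht : (t.map (conjLocal E c v))ᵀ * gramS F E v n T₀ + gramS F E v n T₀ * t = 0) :
    blkB (matA F E c v n (p * nElem F E c v n hJD t ht * p⁻¹)) = blkA (matA F E c v n p) * t * (blkD (matA F E c v n p))⁻¹ := by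
  have h := adapt_matA_conj_nElem F E c v n hJD hC ht
  rw [adapt_eq] at h
  exact (Matrix.fromBlocks_inj.1 h).2.1

/-! ## §2 `w_Δ` swaps the Levi blocks -/

omit [Algebra.IsQuadraticExtension F E] in
include hJD in
/-- **`adapt(matA(w_Δ m w_Δ)) = diag(D, A)`** for a LEVI element `m` (`C = 0 = B`, blocks `A`, `D`). [cite: Kudla1994, §3] [cite: MoeglinWaldspurger1995, II.1.6] -/
theorem adapt_matA_weylDelta_conj {m : UnitaryGroup.localPi E c (n + n) JD v} (hC : blkC (matA F E c v n m) = 0) (hB : blkB (matA F E c v n m) = 0) :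
    adapt (matA F E c v n (weylDelta F E c v n hJD * m * weylDelta F E c v n hJD)) =
      Matrix.fromBlocks (blkD (matA F E c v n m)) 0 0 (blkA (matA F E c v n m)) := by
  rw [← matA_mul, ← matA_mul, adapt_mul, adapt_mul, weylDelta, adapt_matA_ofAdapted, adapt_eq (matA F E c v n m), hC, hB,
    Matrix.fromBlocks_multiply, Matrix.fromBlocks_multiply]
  simp

include hcδ hδ hd hT₀ hJD in
/-- `w_Δ m w_Δ ∈ P_Δ(F_v)` for a Levi element `m`. [cite: Kudla1994, §3] -/
theorem isSiegelDelta_weylDelta_conj {m : UnitaryGroup.localPi E c (n + n) JD v} (hC : blkC (matA F E c v n m) = 0) (hB : blkB (matA F E c v n m) = 0) :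
    IsSiegelDelta F E c hcδ hδ hd v n hT₀ hJD (weylDelta F E c v n hJD * m * weylDelta F E c v n hJD) := by
  rw [isSiegelDelta_iff_blkC_eq_zero F E c hcδ hδ hd v n hT₀ hJD, blkC_eq_toBlocks₂₁_adapt, adapt_matA_weylDelta_conj F E c v n hJD hC hB,
    Matrix.toBlocks_fromBlocks₂₁]

omit [Algebra.IsQuadraticExtension F E] in
include hJD in
/-- the blocks of `w_Δ m w_Δ`: `A ↦ D`, `B ↦ 0`, `C ↦ 0`, `D ↦ A`. [cite: Kudla1994, §3] -/
theorem blocks_matA_weylDelta_conj {m : UnitaryGroup.localPi E c (n + n) JD v} (hC : blkC (matA F E c v n m) = 0) (hB : blkB (matA F E c v n m) = 0) :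
    blkA (matA F E c v n (weylDelta F E c v n hJD * m * weylDelta F E c v n hJD)) = blkD (matA F E c v n m) ∧
      blkB (matA F E c v n (weylDelta F E c v n hJD * m * weylDelta F E c v n hJD)) = 0 ∧
      blkC (matA F E c v n (weylDelta F E c v n hJD * m * weylDelta F E c v n hJD)) = 0 ∧
      blkD (matA F E c v n (weylDelta F E c v n hJD * m * weylDelta F E c v n hJD)) = blkA (matA F E c v n m) := by
  have h := adapt_matA_weylDelta_conj F E c v n hJD hC hB
  rw [adapt_eq] at h
  obtain ⟨h1, h2, h3, h4⟩ := Matrix.fromBlocks_inj.1 h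
  exact ⟨h1, h2, h3, h4⟩

omit [Algebra.IsQuadraticExtension F E] in
include hJD in
/-- **the `Δ`-block of `w_Δ m w_Δ` is `D`** (= `toBlocks₁₁ + toBlocks₁₂` of its matrix over `E ⊗ F_v`), so `det_Δ(w_Δ m w_Δ)_w = (det D)_w`.
[cite: Kudla1994, §3] [cite: HarrisKudlaSweet1996, §1 (1.15)] -/
theorem detDelta_weylDelta_conj {m : UnitaryGroup.localPi E c (n + n) JD v} (hC : blkC (matA F E c v n m) = 0) (hB : blkB (matA F E c v n m) = 0)
    (w : PlacesOver E v) :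
    detDelta F E c v n w (weylDelta F E c v n hJD * m * weylDelta F E c v n hJD) = (blkD (matA F E c v n m)).det w := by
  obtain ⟨h1, -, h3, -⟩ := blocks_matA_weylDelta_conj F E c v n hJD hC hB
  rw [← det_deltaBlockS_apply F E c v n _ w]
  change ((matA F E c v n _).toBlocks₁₁ + (matA F E c v n _).toBlocks₁₂).det w = _
  rw [← blkA_add_blkC, h1, h3, add_zero]

omit [Algebra.IsQuadraticExtension F E] in
/-- the `Δ`-block of a Levi element `m` is `A`: `det_Δ m_w = (det A)_w`. [cite: Kudla1994, §3] -/
theorem detDelta_levi {m : UnitaryGroup.localPi E c (n + n) JD v} (hC : blkC (matA F E c v n m) = 0) (w : PlacesOver E v) :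
    detDelta F E c v n w m = (blkA (matA F E c v n m)).det w := by
  rw [← det_deltaBlockS_apply F E c v n _ w]
  change ((matA F E c v n m).toBlocks₁₁ + (matA F E c v n m).toBlocks₁₂).det w = _
  rw [← blkA_add_blkC, hC, add_zero]

omit [Algebra.IsQuadraticExtension F E] in
include hT₀d hJD in
/-- **`σ(det D) · det A = 1` on `P_Δ(F_v)`** — so `det_Δ(w_Δ m w_Δ) = det D = σ(det A)⁻¹ = σ(det_Δ m)⁻¹`: the Weyl conjugate carries the
inducing character `χ(det_Δ)|det_Δ|^{s+n/2}` to `(χ∘c)⁻¹(det_Δ)|det_Δ|^{−(s+n/2)}·(modulus)`, the source of `χ′ = (χ ∘ c)⁻¹`, `s ↦ −s` in `M(s) : I(s,χ) → I(−s,χ′)`.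
[cite: HarrisKudlaSweet1996, §1 (1.11)–(1.12)] [cite: MoeglinWaldspurger1995, II.1.6] -/
theorem map_det_blkD_mul_det_blkA' {p : UnitaryGroup.localPi E c (n + n) JD v} (hC : blkC (matA F E c v n p) = 0) :
    conjLocal E c v (blkD (matA F E c v n p)).det * (blkA (matA F E c v n p)).det = 1 :=
  map_det_blkD_mul_det_blkA (cstar_matA F E c v n hJD p) hC (isUnit_det_gramS' F E v n hT₀d)

end Summit.HodgeConjecture.HodgeConjecture.Cruxes.HLiu418.K2LiuSiegelLeviWeylAlgebra

end
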